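import Literature.NumberTheory.Sieve.LinearEquationsInPrimes
import Mathlib.NumberTheory.Primorial
import Mathlib.Analysis.SpecialFunctions.Pow.Real
import Mathlib.Analysis.Complex.Basic
import HarnessLib

/-!
# Linear equations in primes: the transference architecture (Green–Tao 2010, §§4–7, App. B)

Trunk T-SIEVE (`Literature/NumberTheory/Sieve`). This file records, as named facts with the
source's own numbering, the top level of the proof of the Green–Tao / Green–Tao–Ziegler theorem
`Literature.NumberTheory.Sieve.GreenTaoZiegler2012_finiteComplexity` (the generalised Hardy–Littlewood conjecture for
systems of finite complexity, `LinearEquationsInPrimes.lean`), following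
B. Green, T. Tao, *Linear equations in primes*, Ann. of Math. 171 (2010):

* the vocabulary the reduction needs and Mathlib lacks (searched `gowers`, `uniformity`,
  `nilsequence`: no hits): the Gowers uniformity norm `‖f‖_{U^k[N]}` of a function on
  `[N] = {1, …, N}` in Green–Tao's intrinsic form (App. B, (B.11)) — `Literature.NumberTheory.Sieve.gowersCubeParams`,
  `Literature.NumberTheory.Sieve.gowersCubeTerm`, `Literature.NumberTheory.Sieve.uniformityAvg`, `Literature.NumberTheory.Sieve.uniformityNorm`; and the `W`-trick of §5 —
  `Literature.wCutoff N = ⌊log log log N⌋₊` (the paper's definite choice of `w`), the modulus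
  `W = ∏_{p ≤ w} p = primorial w` (Mathlib), `Literature.vonMangoldtPrime = Λ'` (restriction of `Λ` to
  the primes) and `Literature.vonMangoldtW W b = Λ'_{b,W}` ((5.1) and the display after it);
* **`Literature.NumberTheory.Sieve.GreenTao2010_gowersUniformity`** — the Gowers uniformity estimate, Thm. 7.2:
  `‖Λ'_{b,W} - 1‖_{U^{s+1}[N]} = o(1)`, now unconditional for every `s ≥ 1` since `GI(s)` is
  Green–Tao–Ziegler 2012, Thm. 1.3 and `MN(s)` is Green–Tao 2012, Thm. 1.1;
* **`Literature.NumberTheory.Sieve.GreenTao2010_transference`** — the content of §§4–7 (with Props. 6.4, 7.1 and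
  Appendices A, C, D): the uniformity estimate implies the Main Theorem ("Using Propositions 6.4
  and 7.1 we reduce Theorem 5.2, and hence the Main Theorem, to the following Gowers uniformity
  estimate", p. 1779);
* the assembled implication `Literature.NumberTheory.Sieve.GreenTaoZiegler2012_finiteComplexity_of_transference`
  (proved: modus ponens), which is how `GreenTaoZiegler2012_finiteComplexity_holds` is to be
  obtained once the two facts are discharged.

## The printed architecture (for the record; GT2010 numbering)

Main Theorem ⇐ Thm. 4.1 (forms `> N^{9/10}` on `K`, removes `β_∞`; linear algebra + App. A)
⇐ Thm. 4.5 (`s`-normal form; Defs. 4.2, 4.3, Lemma 4.4) ⇐ Thm. 5.1 (`W`-trick, pp. 1775–1776: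
uses Lemma 1.3, multiplicativity of `β`, volume packing) ⇐ Thm. 5.2 (product of
`Λ'_{bᵢ,W} - 1`) ⇐ Thm. 7.2 (via Prop. 6.4, the pseudorandom majorant of App. D, and Prop. 7.1,
the generalised von Neumann theorem of App. C). Thm. 7.2 ⇐ Prop. 10.1 (relative inverse theorem,
from `GI(s)`) + Prop. 10.2 (`Λ'_{b,W} - 1` orthogonal to nilsequences, from `MN(s)`, §§11–12).

## Design choices

* `U^k[N]` is Green–Tao's *local* Gowers norm (B.11): the average, over all
  `(x, h) ∈ ℤ × ℤ^k` whose whole cube `{x + ∑_{j ∈ ω} hⱼ : ω ⊆ [k]}` lies in `[N]`, of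
  `∏_ω 𝒞^{|ω|} f(x + ω·h)`, raised to the power `1/2^k`. Every such `(x, h)` has `x ∈ [N]`
  (`ω = ∅`) and `|hⱼ| ≤ N` (`ω = {j}`), so the parameter set is the finite filter
  `gowersCubeParams k N` of the box `[N] × [-N, N]^k` (`mem_gowersCubeParams`); it is non-empty for
  `N ≥ 1` (`h = 0`). Cube vertices are indexed by `ω : Finset (Fin k)` (`{0,1}^k`), and
  `𝒞^{|ω|}` is conjugation iff `|ω|` is odd. The inner average is a non-negative real (App. B),
  so taking `‖·‖` before the real `2^k`-th root is faithful and total. Green–Tao–Ziegler's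
  definition (embedding `[N]` in `ℤ/Ñℤ`, `Ñ ≥ 2^k N`) agrees with (B.11) by (B.12) and the Freiman
  isomorphism remark following it. Functions on `[N]` are functions `ℤ → ℂ` (values off `[N]` are
  never read).
* The cutoff `w`. §5: "fix some slowly growing function `w = w(N)`. Any function such that
  `w(N) ≤ ½ log log N` and `lim w(N) = ∞` would suffice; for sake of definiteness we shall
  conservatively set `w := log log log N`." All later statements (Thms. 5.1, 5.2, 7.2) are made
  under this convention, and the proof of Thm. 5.1 applies Thm. 5.2/7.2 at the scale
  `Ñ = O(N/W)` with the modulus `W = W(w(N))` of the original scale. We therefore state Thm. 7.2 in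
  the form equivalent to "for every admissible `w`": `o(1)` as `N → ∞`, uniformly over integer
  cutoffs `w₀ ≤ w ≤ ½ log log N` (given the per-function statement, a failing sequence
  `(Nᵢ, wᵢ)` with `wᵢ → ∞` defines an admissible step function `w` contradicting it; the converse
  is immediate) and, as the Remark after Thm. 5.1 stresses, uniformly in `b`. Only the primes
  `p ≤ w` enter, so integer cutoffs and `W = primorial w` lose nothing.
* `Λ'_{b,W}` is a function on `ℤ⁺`; we take `W b n : ℕ` and read it on `[N]` through `Int.toNat`.

## References

* B. Green, T. Tao, *Linear equations in primes*, Ann. of Math. (2) 171 (2010), 1753–1850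
  (arXiv:math/0606088): §3 (conventions: `o()` uniform in `Ψ` for fixed `t,d,s,L`), Thm. 4.1,
  Defs. 4.2–4.3, Lemma 4.4, Thm. 4.5, §5 ((5.1), `Λ'`, `Λ'_{b,W}`, Thms. 5.1, 5.2 and the proof of
  the Main Theorem assuming Thm. 5.1), Defs. 6.1–6.3, Prop. 6.4, Prop. 7.1, Thm. 7.2 and "Proof of
  Main Theorem assuming Theorem 7.2", Conj. 8.3 (`GI(s)`), Conj. 8.5 (`MN(s)`), Props. 10.1–10.3,
  App. B (B.11)–(B.12).
* B. Green, T. Tao, *The Möbius function is strongly orthogonal to nilsequences*, Ann. of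
  Math. (2) 175 (2012), 541–566, Thm. 1.1 (`MN(s)` for all `s`).
* B. Green, T. Tao, T. Ziegler, *An inverse theorem for the Gowers `U^{s+1}[N]`-norm*, Ann. of
  Math. (2) 176 (2012), 1231–1372 (arXiv:1009.3998), (1.1)–(1.2), Conj. 1.2, Thm. 1.3 and the
  paragraph following it.
-/

noncomputable section

open Filter Finset
open scoped Topology

namespace Literature.NumberTheory.Sieve

/-! ### Gowers uniformity norms on `[N]` (Green–Tao 2010, App. B) -/

/-- `𝒞^m z`: complex conjugation applied `m` times (`z` for even `m`, `conj z` for odd `m`).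
[cite: GreenTao2010, App. B (before (B.1))] -/
def conjPow (m : ℕ) (z : ℂ) : ℂ :=
  if Even m then z else (starRingEnd ℂ) z

/-- `𝒞⁰ = id`. [folklore] -/
@[simp] theorem conjPow_zero (z : ℂ) : conjPow 0 z = z := by
  simp [conjPow]

/-- `𝒞^m` fixes reals. [folklore] -/
@[simp] theorem conjPow_ofReal (m : ℕ) (r : ℝ) : conjPow m (r : ℂ) = r := by
  unfold conjPow
  split_ifs <;> simp

/-- The vertex `x + ω · h = x + ∑_{j ∈ ω} hⱼ` of the `k`-dimensional cube with base point `x` and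
edges `h`, indexed by `ω ⊆ [k]` (i.e. `ω ∈ {0,1}^k`). [cite: GreenTao2010, App. B (B.11)] -/
def cubeVertex {k : ℕ} (x : ℤ) (h : Fin k → ℤ) (ω : Finset (Fin k)) : ℤ :=
  x + ∑ j ∈ ω, h j

/-- The base point is the vertex `ω = ∅`. [folklore] -/
@[simp] theorem cubeVertex_empty {k : ℕ} (x : ℤ) (h : Fin k → ℤ) : cubeVertex x h ∅ = x := by
  simp [cubeVertex]

/-- The vertex `ω = {j}` is `x + hⱼ`. [folklore] -/
@[simp] theorem cubeVertex_singleton {k : ℕ} (x : ℤ) (h : Fin k → ℤ) (j : Fin k) :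
    cubeVertex x h {j} = x + h j := by
  simp [cubeVertex]

/-- The Gowers cube product `∏_{ω ∈ {0,1}^k} 𝒞^{|ω|} f(x + ω · h)`.
[cite: GreenTao2010, App. B (B.11)] -/
def gowersCubeTerm (k : ℕ) (f : ℤ → ℂ) (x : ℤ) (h : Fin k → ℤ) : ℂ :=
  ∏ ω : Finset (Fin k), conjPow ω.card (f (cubeVertex x h ω))

open Classical in
/-- The parameter set of the local Gowers norm on `[N] = {1, …, N}`: all `(x, h) ∈ ℤ × ℤ^k`
such that every vertex `x + ω · h`, `ω ∈ {0,1}^k`, lies in `[N]`. (Realised as a filter of the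
box `[N] × [-N, N]^k`, which contains all such pairs: `mem_gowersCubeParams`.)
[cite: GreenTao2010, App. B (B.11)] -/
def gowersCubeParams (k N : ℕ) : Finset (ℤ × (Fin k → ℤ)) :=
  ((Icc (1 : ℤ) N) ×ˢ Fintype.piFinset fun _ : Fin k => Icc (-(N : ℤ)) N).filter
    fun p => ∀ ω : Finset (Fin k), cubeVertex p.1 p.2 ω ∈ Icc (1 : ℤ) N

/-- Faithfulness of the finite realisation: `(x, h) ∈ gowersCubeParams k N` iff every vertex of
the cube lies in `[N]`. [cite: GreenTao2010, App. B (B.11)] -/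
theorem mem_gowersCubeParams {k N : ℕ} {x : ℤ} {h : Fin k → ℤ} :
    (x, h) ∈ gowersCubeParams k N ↔ ∀ ω : Finset (Fin k), cubeVertex x h ω ∈ Icc (1 : ℤ) N := by
  classical
  refine ⟨fun hp => (Finset.mem_filter.mp hp).2, fun hω => Finset.mem_filter.mpr ⟨?_, hω⟩⟩
  have hx := hω ∅
  rw [cubeVertex_empty, Finset.mem_Icc] at hx
  refine Finset.mem_product.mpr ⟨Finset.mem_Icc.mpr hx, Fintype.mem_piFinset.mpr fun j => ?_⟩
  have hj := hω {j}
  rw [cubeVertex_singleton, Finset.mem_Icc] at hj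
  show h j ∈ _
  rw [Finset.mem_Icc]
  omega

/-- For `N ≥ 1` the parameter set is non-empty (degenerate cubes `h = 0` based in `[N]`).
[folklore] -/
theorem gowersCubeParams_nonempty (k : ℕ) {N : ℕ} (hN : 1 ≤ N) :
    (gowersCubeParams k N).Nonempty := by
  refine ⟨(1, 0), mem_gowersCubeParams.mpr fun ω => ?_⟩
  simp only [cubeVertex, Pi.zero_apply, Finset.sum_const_zero, add_zero, Finset.mem_Icc]
  exact ⟨le_rfl, by exact_mod_cast hN⟩

/-- The Gowers average `‖f‖_{U^k[N]}^{2^k} = 𝔼_{(x,h) : cube ⊆ [N]} ∏_ω 𝒞^{|ω|} f(x + ω·h)`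
(a non-negative real number, App. B; junk `0` for `N = 0`).
[cite: GreenTao2010, App. B (B.11)] -/
def uniformityAvg (k N : ℕ) (f : ℤ → ℂ) : ℂ :=
  (∑ p ∈ gowersCubeParams k N, gowersCubeTerm k f p.1 p.2) / (gowersCubeParams k N).card

/-- The (local) Gowers uniformity norm `‖f‖_{U^k[N]}` of `f : [N] → ℂ`, `[N] = {1, …, N}`
(values of `f` off `[N]` are not read): the `2^k`-th root of the Gowers average.
[cite: GreenTao2010, App. B (B.11)] [cite: GreenTaoZiegler2012, (1.1)–(1.2)] -/
def uniformityNorm (k N : ℕ) (f : ℤ → ℂ) : ℝ :=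
  ‖uniformityAvg k N f‖ ^ ((2 : ℝ) ^ k)⁻¹

/-- `‖f‖_{U^k[N]} ≥ 0`. [folklore] -/
theorem uniformityNorm_nonneg (k N : ℕ) (f : ℤ → ℂ) : 0 ≤ uniformityNorm k N f :=
  Real.rpow_nonneg (norm_nonneg _) _

/-- `𝒞^m 0 = 0`. [folklore] -/
@[simp] theorem conjPow_apply_zero (m : ℕ) : conjPow m 0 = 0 := by
  unfold conjPow
  split_ifs <;> simp

/-- The zero function has Gowers average `0` (the vertex `ω = ∅` contributes the factor
`f(x) = 0`). [folklore] -/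
theorem uniformityAvg_zero (k N : ℕ) : uniformityAvg k N 0 = 0 := by
  have h0 : gowersCubeTerm k 0 = fun _ _ => 0 := by
    funext x h
    unfold gowersCubeTerm
    exact Finset.prod_eq_zero (Finset.mem_univ ∅) (by simp)
  simp [uniformityAvg, h0]

/-- The zero function has Gowers norm `0` (`0^{1/2^k} = 0`). [folklore] -/
theorem uniformityNorm_zero (k N : ℕ) : uniformityNorm k N 0 = 0 := by
  have hk : ((2 : ℝ) ^ k)⁻¹ ≠ 0 := by positivity
  simp [uniformityNorm, uniformityAvg_zero, Real.zero_rpow hk]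

/-! ### The `W`-trick (Green–Tao 2010, §5) -/

/-- Green–Tao's definite choice of the slowly growing cutoff: `w(N) = log log log N` (integer
part; only the primes `p ≤ w` matter). [cite: GreenTao2010, §5 (Important convention)] -/
def wCutoff (N : ℕ) : ℕ :=
  ⌊Real.log (Real.log (Real.log N))⌋₊

/-- `Λ'`: the restriction of the von Mangoldt function to the primes, `Λ'(p) = log p` for `p`
prime and `Λ'(n) = 0` otherwise. [cite: GreenTao2010, §5 (after (5.1))] -/
def vonMangoldtPrime (n : ℕ) : ℝ :=
  if n.Prime then Real.log n else 0

/-- The `W`-tricked von Mangoldt function `Λ'_{b,W}(n) = (φ(W)/W) Λ'(W n + b)` on `ℤ⁺`, for a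
modulus `W = ∏_{p ≤ w} p` (`primorial w`) and a residue `b ∈ [W]` coprime to `W`.
[cite: GreenTao2010, (5.1) and the display following it] -/
def vonMangoldtW (W b n : ℕ) : ℝ :=
  (Nat.totient W : ℝ) / W * vonMangoldtPrime (W * n + b)

/-- `Λ'` vanishes off the primes. [folklore] -/
theorem vonMangoldtPrime_of_not_prime {n : ℕ} (hn : ¬ n.Prime) : vonMangoldtPrime n = 0 := by
  simp [vonMangoldtPrime, hn]

/-- `Λ'(p) = log p = Λ(p)` at a prime. [folklore] -/
theorem vonMangoldtPrime_prime {p : ℕ} (hp : p.Prime) :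
    vonMangoldtPrime p = ArithmeticFunction.vonMangoldt p := by
  simp [vonMangoldtPrime, hp, ArithmeticFunction.vonMangoldt_apply_prime hp]

/-- `0 ≤ Λ' ≤ Λ` pointwise ("`Λ'` only differs from `Λ` on the prime powers `p², p³, …`").
[cite: GreenTao2010, §5 (after (5.1))] -/
theorem vonMangoldtPrime_le_vonMangoldt (n : ℕ) :
    0 ≤ vonMangoldtPrime n ∧ vonMangoldtPrime n ≤ ArithmeticFunction.vonMangoldt n := by
  by_cases hn : n.Prime
  · rw [vonMangoldtPrime_prime hn]
    exact ⟨ArithmeticFunction.vonMangoldt_nonneg, le_rfl⟩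
  · rw [vonMangoldtPrime_of_not_prime hn]
    exact ⟨le_rfl, ArithmeticFunction.vonMangoldt_nonneg⟩

/-- With the trivial modulus `W = 1` (no `W`-trick, `w < 2`) and `b = 1`, `Λ'_{1,1}(n) = Λ'(n+1)`.
[folklore] -/
example (n : ℕ) : vonMangoldtW 1 1 n = vonMangoldtPrime (n + 1) := by
  simp [vonMangoldtW]

/-- The function `Λ'_{b,W} - 1` on `[N]`, read as a complex-valued function on `ℤ` (the argument
of the Gowers norm in Thm. 7.2). [cite: GreenTao2010, Thm. 7.2] -/
def vonMangoldtWSubOne (W b : ℕ) (n : ℤ) : ℂ :=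
  ((vonMangoldtW W b n.toNat - 1 : ℝ) : ℂ)

/-! ### Named facts: Thm. 7.2 and the transference of §§4–7 -/

/-- **Gowers uniformity of the `W`-tricked primes** (Green–Tao 2010, Thm. 7.2, as printed:
"Let `N, w > 1`, and let `b ∈ [W]` be coprime to `W = ∏_{p ≤ w} p`. Suppose that the inverse
Gowers-norm conjecture `GI(s)` and the Möbius and nilsequences conjecture `MN(s)` are true for some
`s ≥ 1`. Then we have `‖Λ'_{b,W} - 1‖_{U^{s+1}[N]} = o(1)`."; the two hypotheses are now theorems:
`MN(s)` for all `s` is Green–Tao 2012, Thm. 1.1, and `GI(s)` is classical for `s = 1`, Green–Tao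
2008 for `s = 2` and Green–Tao–Ziegler 2012, Thm. 1.3 for `s ≥ 3`). Here `o(1)` is as `N → ∞`
for fixed `s`, uniformly in `b` (Remark after Thm. 5.1) and for the slowly growing cutoff of §5
("any function such that `w(N) ≤ ½ log log N` and `lim w(N) = ∞` would suffice"), rendered in the
equivalent range-uniform form: for every `s ≥ 1` and `ε > 0` there are `w₀, N₀` such that
`‖Λ'_{b,W} - 1‖_{U^{s+1}[N]} ≤ ε` whenever `N ≥ N₀`, `w₀ ≤ w ≤ ½ log log N`, `W = ∏_{p ≤ w} p`,
`b ∈ [W]`, `gcd(b, W) = 1`.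
[cite: GreenTao2010, Thm. 7.2] [cite: GreenTao2012Mobius, Thm. 1.1]
[cite: GreenTaoZiegler2012, Thm. 1.3 and the following paragraph] -/
def GreenTao2010_gowersUniformity : Prop :=
  ∀ s : ℕ, 1 ≤ s → ∀ ε : ℝ, 0 < ε → ∃ w₀ N₀ : ℕ, ∀ N : ℕ, N₀ ≤ N → ∀ w : ℕ, w₀ ≤ w →
    (w : ℝ) ≤ Real.log (Real.log N) / 2 →
      ∀ b : ℕ, 1 ≤ b → b ≤ primorial w → Nat.Coprime b (primorial w) →
        uniformityNorm (s + 1) N (vonMangoldtWSubOne (primorial w) b) ≤ ε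

/-- **Transference: the Gowers uniformity estimate implies the Main Theorem** (Green–Tao 2010,
§§4–7: "Proof of the Main Theorem assuming Theorem 4.1" and the normal-form reduction to Thm. 4.5
(§4, linear algebra and App. A), "Proof of the Main Theorem assuming Theorem 5.1" (the `W`-trick,
§5, using Lemma 1.3), Thm. 5.1 from Thm. 5.2 (expanding the product), and "Proof of Main Theorem
assuming Theorem 7.2" (§7: Prop. 6.4, domination of `1 + Λ'_{b₁,W} + ⋯ + Λ'_{b_t,W}` by a
`D`-pseudorandom measure, App. D; Prop. 7.1, the generalised von Neumann theorem, App. C;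
Bertrand's postulate) — "Using Propositions 6.4 and 7.1 we reduce Theorem 5.2, and hence the Main
Theorem, to the following Gowers uniformity estimate." None of these reductions uses `GI(s)` or
`MN(s)` (§5, first paragraph).) Rendered as the implication from the (all-`s`, range-uniform)
uniformity estimate to the finite-complexity generalised Hardy–Littlewood asymptotic; the printed
reduction is level by level (`U^{s+1}` controls systems of complexity `≤ s`, and finite complexity
means complexity `≤ t - 2`, Lemma 1.6), so this implication has a stronger antecedent than the
source's. [cite: GreenTao2010, §7 (Proof of Main Theorem assuming Theorem 7.2), with §4, §5,
Prop. 6.4, Prop. 7.1] -/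
def GreenTao2010_transference : Prop :=
  GreenTao2010_gowersUniformity → GreenTaoZiegler2012_finiteComplexity

/-- Assembly of the architecture: the transference of §§4–7 and the uniformity estimate Thm. 7.2
(with `GI(s)`, `MN(s)` supplied by Green–Tao–Ziegler 2012 and Green–Tao 2012) give the
Green–Tao–Ziegler theorem. This is the intended shape of
`GreenTaoZiegler2012_finiteComplexity_holds` once both named facts are discharged.
[cite: GreenTao2010, Main Theorem] [cite: GreenTaoZiegler2012, Thm. 1.3 and the following
paragraph] -/
theorem GreenTaoZiegler2012_finiteComplexity_of_transference (h₁ : GreenTao2010_transference)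
    (h₂ : GreenTao2010_gowersUniformity) : GreenTaoZiegler2012_finiteComplexity :=
  h₁ h₂

end Literature.NumberTheory.Sieve
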